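import Literature.AnabelianGeometry.EtaleTheta.Discharge.Sec3Prop34iPhiZero
import Literature.AnabelianGeometry.EtaleTheta.DivisorMonoidsOfGaloisCovering
import Literature.AlgebraicGeometry.Frobenioids.PiNatFixedPointsCountable
import HarnessLib

/-!
# [EtTh] Def 3.3 (iii) / Rmk 3.3.1 at the GENUINE record: `Φ₀(S) = Hom_G(S, Div⁺(Z^log_∞))` and its perfection have
# COUNTABLY many primes when the cusps, the special-fibre components and the `G`-set `S` are countable

S. Mochizuki, *The étale theta function …*, Publ. RIMS **45** (2009) [MochizukiEtTh2009], Def 3.1 (i) PDF p.70 (prime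
log-divisors: irreducible components of the special fibre of the universal combinatorial covering `Z_∞` — indexed by `ℤ`
— and its cusps), Def 3.3 (iii) p.73 (`Φ₀(Y^log) := lim Div⁺(Z^log_∞)^{Gal(Z^log_∞/Y^log)}`), Rmk 3.3.1 p.73 ("the set of
primes of `Div⁺(Z^log_∞)^{Gal(Z^log_∞/Y^log)}` … is in natural bijective correspondence with the set of
`Gal(Z^log_∞/Y^log)`-orbits of prime log-divisors") [cite: MochizukiEtTh2009, Rmk 3.3.1 p.73].

abc-iut cell, seat abc-iut-w5-d153 (gen 4).  PROOF-ONLY (theorems only).  For abc-iut-w6-d058's genuine Def 3.3 (iii)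
pieces `A.phiZero S` (`LogDivisorModelGaloisAction.lean`) / record `DivisorMonoids.ofGaloisAction A hZ`
(`DivisorMonoidsOfGaloisCovering.lean`), following abc-iut-w6-d057's transport chain of `Sec3Prop34iPhiZero.lean`
(`Φ₀(S) ≅` Cartier-valued invariants `⊆ Maps(S, DIV⁺)^Γ ≅ (∏_{S × (Cusp ⊔ Comp)} ℤ≥0)^{Γ₀}`, perf-dense) and this seat's
`PiNat.countable_primes_fixedPoints`:

* `countable_primes_fixedPoints_maps`, `countable_primes_perfection_cartier_fixedPoints_maps` — the links of the chain;
* **`countable_primes_perfection_phiZero`**, `countable_primes_phiZero` — `Prime(Φ₀(S)^pf)` and `Prime(Φ₀(S))` are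
  countable for `[Countable S.V] [Countable Z.Cusp] [Countable Z.Comp]`;
* **`countable_primes_perfection_ofGaloisAction_Φ₀`** — the same for `(DivisorMonoids.ofGaloisAction A hZ).Φ₀.obj Y`.

This is hypothesis (c) "countably many primes" of this seat's `Λ = ℝ` reductions of the Def 3.6 (i) binder `hBinj`
(`Discharge/Sec3BLambdaInjectiveOfRlfR.lean`, weak twin `…OfRlfRWeak.lean`) and the countability hypothesis of
abc-iut-L2-d2's "no phantom support" theorem (GAP-LEDGER G-L2d2-4), DISCHARGED at the genuine record.  HONEST FRAMING:
`LogDivisorModel` / `GaloisAction` are interface records (nothing asserts they arise from a curve; countability of cusps and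
components is an explicit hypothesis, true for the special fibre of a Tate curve's universal combinatorial covering);
nothing here bears on [IUTchIII] Cor. 3.12.
-/

noncomputable section

namespace Literature.AnabelianGeometry.EtaleTheta

open CategoryTheory Opposite Literature.AlgebraicGeometry.Frobenioids Function

universe u

namespace LogDivisorModel.GaloisAction

variable {Z : LogDivisorModel.{u}} {G : Type u} [Group G] (A : Z.GaloisAction G) (S : Action (Type u) G)

/-- **`Prime(Maps(S, DIV⁺)^Γ)` is countable** for countable `S`, `Cusp`, `Comp` and ANY `Γ ≤ Aut` (transport to
`(∏_{S × (Cusp ⊔ Comp)} ℤ≥0)^{Γ₀}`, whose primes are orbits of coordinates). [cite: MochizukiEtTh2009, Rmk 3.3.1 p.73] -/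
theorem countable_primes_fixedPoints_maps [Countable S.V] [Countable Z.Cusp] [Countable Z.Comp]
    (Γ : Subgroup (MulAut (S.V → ↥Z.DIVplus))) :
    Countable (Primes ↥(FixedPoints.submonoid Γ (S.V → ↥Z.DIVplus))) := by
  obtain ⟨Γ₀, ⟨e⟩⟩ := exists_fixedPoints_maps_congr (Z := Z) S Γ
  haveI := PiNat.countable_primes_fixedPoints (J := S.V × (Z.Cusp ⊕ Z.Comp)) Γ₀
  exact countable_primes_of_mulEquiv e.symm

/-- **`Prime((Maps(S, DIV⁺)^Γ)^pf)` is countable** under the same hypotheses. [cite: MochizukiEtTh2009, Rmk 3.3.1 p.73] -/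
theorem countable_primes_perfection_fixedPoints_maps [Countable S.V] [Countable Z.Cusp] [Countable Z.Comp]
    (Γ : Subgroup (MulAut (S.V → ↥Z.DIVplus))) :
    Countable (Primes (Perfection ↥(FixedPoints.submonoid Γ (S.V → ↥Z.DIVplus)))) := by
  haveI := countable_primes_fixedPoints_maps (Z := Z) S Γ
  exact (isPerfFactorialWeak_fixedPoints_maps (Z := Z) S Γ).countable_primes_perfection

/-- **The Cartier-valued invariants (a perf-dense submonoid) have the same primes after perfection**, hence countably
many. [cite: MochizukiEtTh2009, Prop 3.2 p.70] -/
theorem countable_primes_perfection_cartier_fixedPoints_maps [Countable S.V] [Countable Z.Cusp] [Countable Z.Comp]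
    (Γ : Subgroup (MulAut (S.V → ↥Z.DIVplus))) :
    Countable (Primes (Perfection ↥((Submonoid.pi Set.univ fun _ : S.V => Z.Divplus.comap Z.DIVplus.subtype).comap
      (FixedPoints.submonoid Γ (S.V → ↥Z.DIVplus)).subtype))) := by
  obtain ⟨e⟩ := GroupSaturatedSubmonoid.nonempty_perfectionEquiv
    (mem_perfSaturation_cartier_fixedPoints_maps (Z := Z) S Γ)
  haveI := countable_primes_perfection_fixedPoints_maps (Z := Z) S Γ
  exact countable_primes_of_mulEquiv e.symm

/-- **`Prime(Φ₀(S)^pf)` is countable** for `Φ₀(S) = Hom_G(S, Div⁺(Z^log_∞))` whenever `S`, the cusps and the components are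
countable (Rmk 3.3.1: primes = Galois orbits of prime log-divisors). [cite: MochizukiEtTh2009, Rmk 3.3.1 p.73] -/
theorem countable_primes_perfection_phiZero [Countable S.V] [Countable Z.Cusp] [Countable Z.Comp] :
    Countable (Primes (Perfection ↥(A.phiZero S))) := by
  obtain ⟨Γ, ⟨e⟩⟩ := exists_phiZero_mulEquiv A S
  haveI := countable_primes_perfection_cartier_fixedPoints_maps (Z := Z) S Γ
  exact countable_primes_of_mulEquiv (Perfection.congr e)

/-- **`Prime(Φ₀(S))` is countable** under the same hypotheses. [cite: MochizukiEtTh2009, Rmk 3.3.1 p.73] -/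
theorem countable_primes_phiZero [Countable S.V] [Countable Z.Cusp] [Countable Z.Comp] :
    Countable (Primes ↥(A.phiZero S)) := by
  haveI := countable_primes_perfection_phiZero A S
  obtain ⟨hw, -⟩ := isPerfFactorialCof_phiZero A S
  exact (countable_primes_perfection_iff hw.isDivisorial.isSharp).mp ‹_›

/-- **At the assembled Def 3.3 (iii) record**: for every object `Y` of the base with countable underlying `G`-set,
`Prime(Φ₀(Y)^pf)` of `DivisorMonoids.ofGaloisAction A hZ` is countable — hypothesis (c) of
`RealifiedDivisorMonoids.ofRlfR(Weak)_BΛ_map_injective_of_disjoint_supp_of_countable_primes`, DISCHARGED.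
[cite: MochizukiEtTh2009, Rmk 3.3.1 p.73] -/
theorem countable_primes_perfection_ofGaloisAction_Φ₀ [Countable Z.Cusp] [Countable Z.Comp] (hZ : Z.CuspLaws)
    (Y : (Action (Type u) G)ᵒᵖ) [Countable Y.unop.V] :
    Countable (Primes (Perfection ((DivisorMonoids.ofGaloisAction A hZ).Φ₀.obj Y))) :=
  countable_primes_perfection_phiZero A Y.unop

end LogDivisorModel.GaloisAction

end Literature.AnabelianGeometry.EtaleTheta

end
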